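import Summits.Langlands.Langlands.Theses.MirrorPairReflection

/-!
# `MirrorPairReflection.SectorComplement` (stmt-Langlands-12840) — logical position (SUSPECT-EQUIVALENCE audit)

Crux-strategist unit `cstrat-stmt-Langlands-12840-q1` (gen 1, suspect = equivalence; 2026-08-17).
The payload witness `Theorems.skinnerWilesDefectOne_sectorComplement_iff_of_target`
(Theorems/SkinnerWilesDefectOneSectorComplement.lean:51) concerns the HOMONYMOUS frame item of route
SkinnerWilesDefectOne (`ReducibleOrdinaryModular → Langlands`, stmt-Langlands-12923) — a different
statement sharing the short decl name (19 Langlands route files declare a `def SectorComplement : Prop`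
frame and share the directory `Cruxes/SectorComplement/`). This file records, kernel-checked, the
identical position for THIS route's frame
`SectorComplement : Prop := EvenReducibleResidueClassification → _root_.Langlands`:

* `mpr_sectorComplement_of_langlands`: `Langlands → SectorComplement` (the frame is implied by the summit);
* `mpr_sectorComplement_iff_of_target`: under the route target `X = EvenReducibleResidueClassification`,
  `SectorComplement ↔ Langlands` — the suspect equivalence, verbatim for this item;
* `mpr_sectorComplement_iff_of_cruxes`: under the FIVE other binders of the deciding theorem
  (`KummerHerbrandSplitting`, `MirrorCriterion`, `NonSelfMirrorReducible`, `SelfMirrorDihedral`,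
  `ScalarResidueReducible` — which give `X` by the ≈45-line case analysis inside `closes`),
  `SectorComplement ↔ Langlands`: once the route's own items land, this item IS the summit;
* `mpr_not_sectorComplement_iff`: `¬ SectorComplement ↔ X ∧ ¬ Langlands` — a refutation of the frame is a
  PROOF of the open sector classification together with a DISPROOF of the formal summit;
* `mpr_sectorComplement_iff_not_or`: truth table `SectorComplement ↔ ¬ X ∨ Langlands`;
* `mpr_sectorComplement_localLanglandsDebt`: frame + target already give `Nonempty (ReciprocityData F)` for
  every number field `F` (the Harris–Taylor/Henniart conjunct of the summit), far outside the sector —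
  the item carries the whole summit debt, as its docstring says.

Deliberately ABSENT (not derivable, and false-in-spirit): `Langlands → X`. Direction (B) of the summit
(`GaloisToAutomorphic`) speaks only of `IsGeometricFramed` (de Rham at `ℓ`) irreducible `ρ` and concludes
AUTOMORPHY; `X` quantifies over ALL continuous even `σ : Γ_ℚ → GL₂(ℚ̄_p)` of conductor `p^∞` with
reducible residue (no de Rham hypothesis) and concludes REDUCIBILITY, or dihedrality at
Ankeny–Artin–Chowla primes. So `X` is not a formal (nor a mathematical) corollary of the summit, the
bookkeeping identity `Langlands ↔ X ∧ SectorComplement` does NOT hold here (contrast PART I of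
`Cruxes/SectorComplement/Disproof.lean` for EisensteinGelfandKirillov, whose sector IS inside the summit),
and `X ∧ SectorComplement` is strictly STRONGER than `Langlands` unless `X` is a theorem.

Verdict of the audit (`Cruxes/SectorComplement/EQUIVALENCE-AUDIT_MirrorPairReflection.md`):
equivalence-benign — no item of the route is proved; the conditioning siblings are open
(`NonSelfMirrorReducible`, `SelfMirrorDihedral`: open problems; `MirrorCriterion`,
`KummerHerbrandSplitting`, `ScalarResidueReducible`: theorems on paper, L/XL/M formalizations absent from
the tree), refuter-vetted, probe-CLEAN, and none gives `Langlands` on its own.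

No `sorry`. Nothing here asserts the crux, the target or the summit.
-/

set_option linter.dupNamespace false

namespace Summit.Langlands.Langlands.Cruxes.SectorComplement.EquivalenceAuditMPR

open Summit.Langlands.Langlands.Theses.MirrorPairReflection

/-- The frame is implied by the summit (discard the sector hypothesis). [folklore] -/
theorem mpr_sectorComplement_of_langlands : _root_.Langlands → SectorComplement :=
  fun h _ ↦ h

/-- Under the route target `EvenReducibleResidueClassification` the frame IS the summit — the suspect
equivalence for THIS item (same two-line proof as the SkinnerWilesDefectOne witness). [folklore] -/
theorem mpr_sectorComplement_iff_of_target (hX : EvenReducibleResidueClassification) :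
    SectorComplement ↔ _root_.Langlands :=
  ⟨fun hC ↦ hC hX, fun h _ ↦ h⟩

/-- Under the five other binders of the deciding theorem the frame is equivalent to the summit
(`→` is the route's sorry-free `closes`, which derives the target from them inline). [folklore] -/
theorem mpr_sectorComplement_iff_of_cruxes (hK : KummerHerbrandSplitting) (hM : MirrorCriterion)
    (hN : NonSelfMirrorReducible) (hS : SelfMirrorDihedral) (hR : ScalarResidueReducible) :
    SectorComplement ↔ _root_.Langlands :=
  ⟨fun hC ↦ closes hK hM hN hS hR hC, fun h _ ↦ h⟩

/-- The glue item `CruxesToClassification` (cruxes ⟹ target) turns the target form of the position into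
the crux form. [folklore] -/
theorem mpr_sectorComplement_iff_of_cruxes' (hG : CruxesToClassification) (hK : KummerHerbrandSplitting)
    (hM : MirrorCriterion) (hN : NonSelfMirrorReducible) (hS : SelfMirrorDihedral)
    (hR : ScalarResidueReducible) : SectorComplement ↔ _root_.Langlands :=
  mpr_sectorComplement_iff_of_target (hG hK hM hN hS hR)

/-- Exact content of a refutation of the frame: prove the (open) sector classification AND disprove
the formal summit. [folklore] -/
theorem mpr_not_sectorComplement_iff :
    ¬ SectorComplement ↔ EvenReducibleResidueClassification ∧ ¬ _root_.Langlands :=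
  Classical.not_imp

/-- Truth table of the frame: provable only by proving the summit or refuting the target; refutable
only in the world "target true, summit false". [folklore] -/
theorem mpr_sectorComplement_iff_not_or :
    SectorComplement ↔ ¬ EvenReducibleResidueClassification ∨ _root_.Langlands :=
  imp_iff_not_or

/-- The frame carries the summit's shared Statement debt: with the target it yields reciprocity data
(`Nonempty (ReciprocityData F)`, the summit's non-vacuity conjunct: a local Langlands datum at every
finite place, pinned `ε`/Artin normalisations) for EVERY number field `F` — Harris–Taylor/Henniart
content, far outside the even conductor-`p^∞` `GL₂/ℚ` sector. [folklore] -/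
theorem mpr_sectorComplement_localLanglandsDebt (hC : SectorComplement)
    (hX : EvenReducibleResidueClassification) (F : Type) [Field F] [NumberField F] :
    Nonempty (Summit.Langlands.ReciprocityData F) :=
  (hC hX F).1

/-- … and, for every reciprocity datum, BOTH directions of reciprocity for every `GL_n/F`, `0 < n` —
the frame specialises to the full correspondence, not to the sector. [folklore] -/
theorem mpr_sectorComplement_allRanks (hC : SectorComplement)
    (hX : EvenReducibleResidueClassification) (F : Type) [Field F] [NumberField F]
    (𝓡 : Summit.Langlands.ReciprocityData F) (n : ℕ) (hn : 0 < n)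
    (hcpt : Literature.NumberTheory.Automorphic.isCompact_glFiniteIntegralLevel n F) :
    Summit.Langlands.GlobalLanglandsCorrespondenceGLn n F 𝓡 hcpt :=
  (hC hX F).2 𝓡 n hn hcpt

end Summit.Langlands.Langlands.Cruxes.SectorComplement.EquivalenceAuditMPR
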